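import Summits.QuantumFields.YangMills.Theorems.BalabanUVNodesN18BoxStokesGrowth
import Summits.QuantumFields.YangMills.Theorems.AlphaInputsT3ACv3FourBlockGeom
import HarnessLib

/-!
# N18 (β)-transport letters: the (0.4) loop variables and the side-`L` squares of a norm-bounded configuration from its plaquettes

[DAGN18W3-G4 INTENT-7, file (7b)] — count-neutral helper toward K3⁷ `stmt-QuantumFields-20544` (NOT claimed, NOT closed).  YM mass gap (Clay) NOT proved by
any of this; R4 closes the conditional finite-𝕋⁴ rung `BalabanLadder.UV` only.

The torus dictionary of p615425 §2–§3 in the GROWTH currency of (7a) `BalabanUVNodesN18BoxStokesGrowth`: for an `𝔸ˣ`-valued configuration `U` on `T^{(j)}`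
(`j+1 ≤ m+K`) with `‖U(b)‖, ‖U(b)⁻¹‖ ≤ K` (`K ≥ 1`) on the bonds of the two-block (resp. four-block) box and `‖∂U(p) − 1‖ ≤ a` on its plaquettes — the
situation of a `Gᶜ = SL(N, ℂ)`-valued `𝐔 = (exp iηA′)U` under [Balaban1987RG1] (1.13)–(1.14), `K = 1 + 2ηα₁`, `a = α₀η²` —
* §1 ★ `norm_loopVarU_sub_one_le_of_plaq_twoBlock_growth`: every (0.4) loop variable `W_i(c) = 𝐔(Γ ∪ [x,x′] ∪ (−Γ′) ∪ (−c))` of W1's complexified average satisfies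
  `‖W_i(c) − 1‖ ≤ (1 + γ₂)^{(d+2)L} − 1`, `γ₂ = γ(K, R₂, K⁴a)`, `R₂ = ⌊(d+2)L∕2⌋`, where `γ(K, R, α) = K^{2R+1}·K^{4R}·R·K⁶α·(K²(1+K⁶α))^R` is (7a)'s rate (both
  orientations of the box plaquettes are within `K⁴a`: the reversed one is the inverse of a product of four bond variables);
* §2 ★ `norm_holT_rectWord_sub_one_le_of_plaq_fourBlock_growth`: the side-`L` square `𝐔(∂□)`, `□ = [emb y, emb y + Le_μ + Le_ν]`, read from `emb y`
  (`T4ReflectionCone.rectWord μ ν L L`) satisfies `‖𝐔(∂□) − 1‖ ≤ (1 + γ₄)^{4L} − 1`, `γ₄ = γ(K, R₄, K⁴a)`, `R₄ = ⌊(d+4)L∕2⌋`, from the four-block box of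
  `pub-balaban3d`'s `AlphaInputsT3ACv3FourBlockGeom.blockOf_mem_four_of_near` (prefix bookkeeping `netDisp_take_rectWord_bounds`).
These are the two loop inputs of the plaquette letter `|∂Ū(𝐔) − 1|` of the COMPLEX averaged field ([Balaban1985Averaging] Prop. 1 (51) for `Gᶜ`-valued fields).

0 `def`, 0 `sorry`.  References: T. Bałaban, CMP **109** (1987) 249–301 [Balaban1987RG1] ((0.4) p.253, (1.13)–(1.14) p.262); CMP **98** (1985) 17–51
[Balaban1985Averaging] ((9) p.18, (19)–(20) p.21, pp.24–25, Prop. 1 p.26).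
-/

noncomputable section

open scoped BigOperators

namespace YMDAG.N18.BoxStokes

open Literature.MathematicalPhysics.QuantumFieldTheory.Balaban1983to89
open Literature.MathematicalPhysics.QuantumFieldTheory.Balaban1983to89.B7Prop1Explicit renaming Site → LSite
open Literature.MathematicalPhysics.QuantumFieldTheory.Balaban1983to89.B7Prop1Explicit (Letter e e_apply disp disp_cons disp_nil hol hol_cons hol_nil l1 plaqWord)
open Literature.MathematicalPhysics.QuantumFieldTheory.Balaban1983to89.B7Prop1Local (InBox PlaqIn)
open Literature.MathematicalPhysics.QuantumFieldTheory.Balaban1983to89.T4Continuum (netDisp netDisp_cons loopWord netDisp_take_loopWord netDisp_loopWord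
  blockOf_eq_of_near_emb emb_shift_apply take_append_cases netDisp_take_replicate)
open Literature.MathematicalPhysics.QuantumFieldTheory.Balaban1983to89.T4ReflectionCone (rectWord netDisp_rectWord netDisp_append netDisp_replicate)
open Literature.MathematicalPhysics.QuantumFieldTheory.Balaban1983to89.BlockAveraging (Idx off off_bounds)
open Literature.MathematicalPhysics.QuantumFieldTheory.Balaban1983to89.B10Eq27TorusAxialLog (transl transl_apply transl_add_e pull pull_apply hol_pull hol_pull_zero
  holT holT_plaqWord holT_plaqWord_swap)
open Literature.MathematicalPhysics.QuantumFieldTheory.Balaban1983to89.B12RegularSpaces111 (plaq plaq_eq)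
open Literature.MathematicalPhysics.QuantumFieldTheory.Balaban1983to89.Node00.W1 (loopVarU)
open Summit.QuantumFields.YangMills.Theorems.BoxStokes (blockOf_mem_four_of_near)

variable {P : Params} {j : ℕ} {𝔸 : Type*} [NormedRing 𝔸] [NormOneClass 𝔸]

/-! ## §1 The two-block box: the (0.4) loop variables -/

section TwoBlock

omit [NormOneClass 𝔸] in
/-- **The periodic pullback about `emb c₋` has `‖·‖, ‖·⁻¹‖ ≤ K` on the bonds of the two-block box** when `U` does on the bonds with both ends in `B(c₋) ∪ B(c₊)`.
[cite: Balaban1987RG1, (0.3)-(0.4) pp.252-253] -/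
theorem pull_growth_of_twoBlock (hj : j + 1 ≤ P.m + P.K) {U : GaugeField P j 𝔸ˣ} (c : PBond P (j + 1)) {K : ℝ}
    (hK : ∀ b : PBond P j, (blockOf b.src = c.src ∨ blockOf b.src = c.tgt) → (blockOf b.tgt = c.src ∨ blockOf b.tgt = c.tgt) →
      ‖((U b : 𝔸ˣ) : 𝔸)‖ ≤ K ∧ ‖(((U b)⁻¹ : 𝔸ˣ) : 𝔸)‖ ≤ K)
    (z : LSite P.d) (κ : Fin P.d)
    (hz : InBox (fun _ => -(((P.L - 1) / 2 : ℕ) : ℤ)) (fun ν => (if c.dir = ν then (P.L : ℤ) else 0) + (((P.L - 1) / 2 : ℕ) : ℤ)) z)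
    (hzκ : InBox (fun _ => -(((P.L - 1) / 2 : ℕ) : ℤ)) (fun ν => (if c.dir = ν then (P.L : ℤ) else 0) + (((P.L - 1) / 2 : ℕ) : ℤ)) (z + e κ)) :
    ‖((pull U (emb c.src) z κ : 𝔸ˣ) : 𝔸)‖ ≤ K ∧ ‖(((pull U (emb c.src) z κ)⁻¹ : 𝔸ˣ) : 𝔸)‖ ≤ K := by
  rw [pull_apply]
  refine hK _ (blockOf_transl_emb hj c (fun ν => hz ν)) ?_
  rw [PBond.tgt, ← transl_add_e]
  exact blockOf_transl_emb hj c (fun ν => hzκ ν)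

omit [NormOneClass 𝔸] in
/-- The inverse of a plaquette variable `U(b₁)U(b₂)U(b₃)⁻¹U(b₄)⁻¹` has norm `≤ K⁴` when the four bond variables and their inverses have norm `≤ K`.
[cite: Balaban1985Averaging, (9) p.19] -/
theorem norm_plaq_inv_le_growth {u₁ u₂ u₃ u₄ : 𝔸ˣ} {K : ℝ} (hK0 : 0 ≤ K) (h₁ : ‖((u₁⁻¹ : 𝔸ˣ) : 𝔸)‖ ≤ K) (h₂ : ‖((u₂⁻¹ : 𝔸ˣ) : 𝔸)‖ ≤ K)
    (h₃ : ‖(u₃ : 𝔸)‖ ≤ K) (h₄ : ‖(u₄ : 𝔸)‖ ≤ K) :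
    ‖(((u₁ * u₂ * u₃⁻¹ * u₄⁻¹)⁻¹ : 𝔸ˣ) : 𝔸)‖ ≤ K ^ 4 := by
  rw [mul_inv_rev, mul_inv_rev, mul_inv_rev, inv_inv, inv_inv, Units.val_mul, Units.val_mul, Units.val_mul]
  calc _ ≤ ‖(u₄ : 𝔸)‖ * ‖(u₃ : 𝔸) * (((u₂⁻¹ : 𝔸ˣ) : 𝔸) * ((u₁⁻¹ : 𝔸ˣ) : 𝔸))‖ := norm_mul_le _ _
    _ ≤ ‖(u₄ : 𝔸)‖ * (‖(u₃ : 𝔸)‖ * (‖((u₂⁻¹ : 𝔸ˣ) : 𝔸)‖ * ‖((u₁⁻¹ : 𝔸ˣ) : 𝔸)‖)) := by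
        gcongr
        exact (norm_mul_le _ _).trans (by gcongr; exact norm_mul_le _ _)
    _ ≤ K * (K * (K * K)) := by gcongr
    _ = K ^ 4 := by ring

omit [NormOneClass 𝔸] in
/-- **The plaquette variables of the pullback inside the two-block box, both orientations, are within `K⁴a` of `1`** when the plaquettes of `U` with all four corners in
`B(c₋) ∪ B(c₊)` are within `a` and the bond variables there have `‖·‖, ‖·⁻¹‖ ≤ K` (`K ≥ 1`): the reversed orientation is the inverse `P⁻¹`,
`‖P⁻¹ − 1‖ ≤ ‖P⁻¹‖·‖P − 1‖ ≤ K⁴a`. [cite: Balaban1985Averaging, (9) p.19 and (19)-(20) p.21] -/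
theorem norm_hol_pull_plaqWord_sub_one_le_of_twoBlock_growth (hj : j + 1 ≤ P.m + P.K) {U : GaugeField P j 𝔸ˣ} (c : PBond P (j + 1)) {K a : ℝ}
    (hK1 : 1 ≤ K) (ha : 0 ≤ a)
    (hK : ∀ b : PBond P j, (blockOf b.src = c.src ∨ blockOf b.src = c.tgt) → (blockOf b.tgt = c.src ∨ blockOf b.tgt = c.tgt) →
      ‖((U b : 𝔸ˣ) : 𝔸)‖ ≤ K ∧ ‖(((U b)⁻¹ : 𝔸ˣ) : 𝔸)‖ ≤ K)
    (hplaq : ∀ p : Plaq P j, (blockOf p.src = c.src ∨ blockOf p.src = c.tgt) →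
      (blockOf (p.src.shift p.μ) = c.src ∨ blockOf (p.src.shift p.μ) = c.tgt) →
      (blockOf (p.src.shift p.ν) = c.src ∨ blockOf (p.src.shift p.ν) = c.tgt) →
      (blockOf ((p.src.shift p.μ).shift p.ν) = c.src ∨ blockOf ((p.src.shift p.μ).shift p.ν) = c.tgt) →
      ‖((plaq U p : 𝔸ˣ) : 𝔸) - 1‖ ≤ a)
    (z : LSite P.d) (κ μ : Fin P.d) (hκμ : κ ≠ μ)
    (hp : PlaqIn (fun _ => -(((P.L - 1) / 2 : ℕ) : ℤ)) (fun ν => (if c.dir = ν then (P.L : ℤ) else 0) + (((P.L - 1) / 2 : ℕ) : ℤ)) (z, κ, μ)) :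
    ‖((hol (pull U (emb c.src)) z (plaqWord κ μ) : 𝔸ˣ) : 𝔸) - 1‖ ≤ K ^ 4 * a := by
  have hK0 : 0 ≤ K := zero_le_one.trans hK1
  obtain ⟨hz, hzκμ⟩ := hp
  have hzκ := inBox_add_e_of_inBox_add_add hz hzκμ
  have hzμκ : InBox (fun _ => -(((P.L - 1) / 2 : ℕ) : ℤ)) (fun ν => (if c.dir = ν then (P.L : ℤ) else 0) + (((P.L - 1) / 2 : ℕ) : ℤ)) (z + e μ + e κ) := by
    rwa [add_right_comm]
  have hzμ := inBox_add_e_of_inBox_add_add hz hzμκ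
  have c1 := blockOf_transl_emb hj c (fun ν => hz ν)
  have c2 := blockOf_transl_emb hj c (fun ν => hzκ ν)
  have c3 := blockOf_transl_emb hj c (fun ν => hzμ ν)
  have c4 := blockOf_transl_emb hj c (fun ν => hzκμ ν)
  have c4' := blockOf_transl_emb hj c (fun ν => hzμκ ν)
  rw [transl_add_e] at c2 c3
  rw [transl_add_e, transl_add_e] at c4 c4'
  rw [hol_pull]
  have h4 : a ≤ K ^ 4 * a := by have : (1 : ℝ) ≤ K ^ 4 := one_le_pow₀ hK1; nlinarith
  rcases lt_or_gt_of_ne hκμ with hlt | hgt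
  · have h := hplaq ⟨transl (emb c.src) z, κ, μ, hlt⟩ c1 c2 c3 c4
    rw [plaq_eq, ← holT_plaqWord] at h
    exact h.trans h4
  · -- `μ < κ`: the inverse of the plaquette `⟨emb c₋ + z; μ, κ⟩`
    have h := hplaq ⟨transl (emb c.src) z, μ, κ, hgt⟩ c1 c3 c2 c4'
    rw [plaq_eq, ← holT_plaqWord] at h
    set Q := holT U (transl (emb c.src) z) (plaqWord μ κ) with hQ
    have hQ4 : ‖((Q⁻¹ : 𝔸ˣ) : 𝔸)‖ ≤ K ^ 4 := by
      rw [hQ, holT_plaqWord]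
      exact norm_plaq_inv_le_growth hK0 (hK ⟨transl (emb c.src) z, μ⟩ c1 c3).2 (hK ⟨(transl (emb c.src) z).shift μ, κ⟩ c3 c4').2
        (hK ⟨(transl (emb c.src) z).shift κ, μ⟩ c2 c4).1 (hK ⟨transl (emb c.src) z, κ⟩ c1 c2).1
    rw [holT_plaqWord_swap, ← hQ]
    have h1 : ‖((Q⁻¹ : 𝔸ˣ) : 𝔸) - 1‖ ≤ ‖((Q⁻¹ : 𝔸ˣ) : 𝔸)‖ * ‖(Q : 𝔸) - 1‖ := by
      rw [show ((Q⁻¹ : 𝔸ˣ) : 𝔸) - 1 = ((Q⁻¹ : 𝔸ˣ) : 𝔸) * (1 - (Q : 𝔸)) by rw [mul_sub, mul_one, Units.inv_mul], ← norm_sub_rev (1 : 𝔸) (Q : 𝔸)]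
      exact norm_mul_le _ _
    exact h1.trans (mul_le_mul hQ4 h (norm_nonneg _) (pow_nonneg hK0 4))

/-- The two-block box has `ℓ¹`-radius `≤ ⌊(d+2)L∕2⌋` about the centre. [cite: Balaban1987RG1, (0.3)-(0.4) pp.252-253] -/
theorem l1_le_half_of_inBox_twoBlock (c : PBond P (j + 1)) (z : LSite P.d)
    (hz : InBox (fun _ => -(((P.L - 1) / 2 : ℕ) : ℤ)) (fun ν => (if c.dir = ν then (P.L : ℤ) else 0) + (((P.L - 1) / 2 : ℕ) : ℤ)) z) :
    l1 (z - 0) ≤ (P.d + 2) * P.L / 2 := by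
  rw [sub_zero]
  have h2 := two_mul_l1_le_of_inBox c (fun ν => hz ν)
  omega

/-- ★ **THE (0.4) LOOP VARIABLES OF A NORM-BOUNDED CONFIGURATION FROM THE PLAQUETTES OF THE TWO-BLOCK BOX** (growth twin of p615425 ★★★): if
`‖U(b)‖, ‖U(b)⁻¹‖ ≤ K` (`K ≥ 1`) on the bonds with both ends in `B(c₋) ∪ B(c₊)` and `‖∂U(p) − 1‖ ≤ a` on the plaquettes with all four corners there, then every loop
variable of W1's complexified (0.4) average satisfies `‖W_i(c) − 1‖ ≤ (1 + γ₂)^{(d+2)L} − 1`,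
`γ₂ = K^{2R+1}·(K^{4R}·(R·K⁶(K⁴a)·(K²(1+K⁶(K⁴a)))^R))`, `R = ⌊(d+2)L∕2⌋` ((7a) ★★★ on the periodic pullback; loop length `≤ (d+2)L`).
[cite: Balaban1987RG1, (0.4) p.253 and (1.13)-(1.14) p.262; Balaban1985Averaging, pp.24-25] -/
theorem norm_loopVarU_sub_one_le_of_plaq_twoBlock_growth (hj : j + 1 ≤ P.m + P.K) {U : GaugeField P j 𝔸ˣ} (c : PBond P (j + 1)) {K a : ℝ}
    (hK1 : 1 ≤ K) (ha : 0 ≤ a)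
    (hK : ∀ b : PBond P j, (blockOf b.src = c.src ∨ blockOf b.src = c.tgt) → (blockOf b.tgt = c.src ∨ blockOf b.tgt = c.tgt) →
      ‖((U b : 𝔸ˣ) : 𝔸)‖ ≤ K ∧ ‖(((U b)⁻¹ : 𝔸ˣ) : 𝔸)‖ ≤ K)
    (hplaq : ∀ p : Plaq P j, (blockOf p.src = c.src ∨ blockOf p.src = c.tgt) →
      (blockOf (p.src.shift p.μ) = c.src ∨ blockOf (p.src.shift p.μ) = c.tgt) →
      (blockOf (p.src.shift p.ν) = c.src ∨ blockOf (p.src.shift p.ν) = c.tgt) →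
      (blockOf ((p.src.shift p.μ).shift p.ν) = c.src ∨ blockOf ((p.src.shift p.μ).shift p.ν) = c.tgt) →
      ‖((plaq U p : 𝔸ˣ) : 𝔸) - 1‖ ≤ a) (i : Idx P) :
    ‖((loopVarU U c i : 𝔸ˣ) : 𝔸) - 1‖ ≤
      (1 + K ^ (2 * ((P.d + 2) * P.L / 2) + 1) * (K ^ (4 * ((P.d + 2) * P.L / 2)) * (((P.d + 2) * P.L / 2 : ℕ) * (K ^ 6 * (K ^ 4 * a)) *
        (K ^ 2 * (1 + K ^ 6 * (K ^ 4 * a))) ^ ((P.d + 2) * P.L / 2)))) ^ ((P.d + 2) * P.L) - 1 := by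
  have hK0 : 0 ≤ K := zero_le_one.trans hK1
  have hw0 : disp (loopWord P.L c.dir (off i.1) i.2.1 i.2.2) = 0 := funext fun ν => by
    rw [disp_apply_eq_netDisp]; exact netDisp_loopWord _ _ _ _ _ ν
  have hmain := norm_hol_closed_sub_one_le_inBox_growth (twoBlockBox_lo_le_hi c) hK1 (pull_growth_of_twoBlock hj c hK)
    (mul_nonneg (pow_nonneg hK0 4) ha) (norm_hol_pull_plaqWord_sub_one_le_of_twoBlock_growth hj c hK1 ha hK hplaq) 0
    (l1_le_half_of_inBox_twoBlock c) _ hw0 (inBox_disp_take_loopWord c i)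
  rw [hol_pull_zero] at hmain
  unfold loopVarU
  refine hmain.trans (sub_le_sub_right (pow_le_pow_right₀ ?_ (LatticeWordStokes.length_loopWord_le c i)) _)
  have : 0 ≤ K ^ (2 * ((P.d + 2) * P.L / 2) + 1) * (K ^ (4 * ((P.d + 2) * P.L / 2)) * (((P.d + 2) * P.L / 2 : ℕ) * (K ^ 6 * (K ^ 4 * a)) *
      (K ^ 2 * (1 + K ^ 6 * (K ^ 4 * a))) ^ ((P.d + 2) * P.L / 2))) := by positivity
  linarith

end TwoBlock

/-! ## §2 The four-block box: the side-`L` square -/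

section FourBlock

/-- **PREFIXES OF THE RECTANGLE WORD** `(+e_μ)^a (+e_ν)^b (−e_μ)^a (−e_ν)^b`: the displacement along `κ` lies in `[0, a·[μ = κ] + b·[ν = κ]]`. [folklore] -/
theorem netDisp_take_rectWord_bounds {d : ℕ} (μ ν : Fin d) (a b k : ℕ) (κ : Fin d) :
    0 ≤ netDisp ((rectWord μ ν a b).take k) κ ∧
      netDisp ((rectWord μ ν a b).take k) κ ≤ (if μ = κ then (a : ℤ) else 0) + (if ν = κ then (b : ℤ) else 0) := by
  unfold rectWord
  rcases take_append_cases (List.replicate a (μ, true) ++ List.replicate b (ν, true) ++ List.replicate a (μ, false)) (List.replicate b (ν, false)) k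
    with h | h <;> rw [h]
  · rcases take_append_cases (List.replicate a (μ, true) ++ List.replicate b (ν, true)) (List.replicate a (μ, false)) k with h' | h' <;> rw [h']
    · rcases take_append_cases (List.replicate a (μ, true)) (List.replicate b (ν, true)) k with h'' | h'' <;> rw [h'']
      · rw [netDisp_take_replicate]
        by_cases hμ : μ = κ <;> by_cases hν : ν = κ <;> simp [hμ, hν]
      · rw [netDisp_append, netDisp_replicate, netDisp_take_replicate]
        (by_cases hμ : μ = κ <;> by_cases hν : ν = κ <;> simp [hμ, hν]); omega
    · rw [netDisp_append, netDisp_append, netDisp_replicate, netDisp_replicate, netDisp_take_replicate]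
      by_cases hμ : μ = κ <;> by_cases hν : ν = κ <;> simp [hμ, hν]
  · rw [netDisp_append, netDisp_append, netDisp_append, netDisp_replicate, netDisp_replicate, netDisp_replicate, netDisp_take_replicate]
    (by_cases hμ : μ = κ <;> by_cases hν : ν = κ <;> simp [hμ, hν]); omega

/-- The walk of the side-`L` square from the centre `emb y` stays in the four-block box `[−h, h + L·[κ ∈ {μ, ν}]]`. [folklore] -/
theorem inBox_disp_take_rectWord {μ ν : Fin P.d} (hμν : μ ≠ ν) (k : ℕ) :
    InBox (fun _ => -(((P.L - 1) / 2 : ℕ) : ℤ)) (fun κ => (if κ = μ ∨ κ = ν then (P.L : ℤ) else 0) + (((P.L - 1) / 2 : ℕ) : ℤ))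
      ((0 : LSite P.d) + disp ((rectWord μ ν P.L P.L).take k)) := fun κ => by
  rw [zero_add, disp_apply_eq_netDisp]
  obtain ⟨h0, h1⟩ := netDisp_take_rectWord_bounds μ ν P.L P.L k κ
  dsimp only
  constructor
  · omega
  · rcases eq_or_ne μ κ with hμ | hμ <;> rcases eq_or_ne ν κ with hν | hν
    · exact absurd (hμ.trans hν.symm) hμν
    · rw [if_pos hμ, if_neg hν] at h1; rw [if_pos (Or.inl hμ.symm)]; omega
    · rw [if_neg hμ, if_pos hν] at h1; rw [if_pos (Or.inr hν.symm)]; omega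
    · rw [if_neg hμ, if_neg hν] at h1; rw [if_neg (not_or.mpr ⟨Ne.symm hμ, Ne.symm hν⟩)]; omega

/-- The four-block box is a genuine box (`lo ≤ hi`). [folklore] -/
theorem fourBlockBox_lo_le_hi (μ ν κ : Fin P.d) :
    (fun _ => -(((P.L - 1) / 2 : ℕ) : ℤ) : LSite P.d) κ ≤ (fun κ => (if κ = μ ∨ κ = ν then (P.L : ℤ) else 0) + (((P.L - 1) / 2 : ℕ) : ℤ) : LSite P.d) κ := by
  dsimp only
  split_ifs <;> omega

/-- The four-block box has `ℓ¹`-radius `≤ ⌊(d+4)L∕2⌋` about the centre. [folklore] -/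
theorem l1_le_half_of_inBox_fourBlock (μ ν : Fin P.d) (z : LSite P.d)
    (hz : InBox (fun _ => -(((P.L - 1) / 2 : ℕ) : ℤ)) (fun κ => (if κ = μ ∨ κ = ν then (P.L : ℤ) else 0) + (((P.L - 1) / 2 : ℕ) : ℤ)) z) :
    l1 (z - 0) ≤ (P.d + 4) * P.L / 2 := by
  rw [sub_zero]
  have hL := AveragingRT.two_mul_half_add_one P
  set h : ℕ := (P.L - 1) / 2 with hh
  have hle : ∀ κ, (z κ).natAbs ≤ h + (if κ = μ ∨ κ = ν then P.L else 0) := fun κ => by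
    have := hz κ
    dsimp only at this
    split_ifs at this ⊢ <;> omega
  have hsum : l1 z ≤ ∑ κ : Fin P.d, (h + (if κ = μ ∨ κ = ν then P.L else 0)) := Finset.sum_le_sum fun κ _ => hle κ
  rw [Finset.sum_add_distrib, Finset.sum_const, Finset.card_univ, Fintype.card_fin, smul_eq_mul, Finset.sum_ite, Finset.sum_const_zero, add_zero,
    Finset.sum_const, smul_eq_mul] at hsum
  have hcard : (Finset.univ.filter (fun κ : Fin P.d => κ = μ ∨ κ = ν)).card ≤ 2 := by
    have : Finset.univ.filter (fun κ : Fin P.d => κ = μ ∨ κ = ν) ⊆ {μ, ν} := by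
      intro κ hκ
      simp only [Finset.mem_filter, Finset.mem_univ, true_and] at hκ
      rcases hκ with h | h <;> simp [h]
    exact (Finset.card_le_card this).trans Finset.card_le_two
  have h3 : l1 z ≤ P.d * h + 2 * P.L := hsum.trans (by nlinarith)
  have h4 : 2 * (P.d * h + 2 * P.L) ≤ (P.d + 4) * P.L := by nlinarith
  omega

/-- **A point of the four-block box about `emb y` is a site of `B(y) ∪ B(y+e_μ) ∪ B(y+e_ν) ∪ B(y+e_μ+e_ν)`** (`AlphaInputsT3ACv3FourBlockGeom.blockOf_mem_four_of_near`
read on the translate `emb y + z`). [folklore] -/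
theorem blockOf_transl_emb_four (hj : j + 1 ≤ P.m + P.K) (y : Site P (j + 1)) {μ ν : Fin P.d} (hμν : μ ≠ ν) {z : LSite P.d}
    (hz : InBox (fun _ => -(((P.L - 1) / 2 : ℕ) : ℤ)) (fun κ => (if κ = μ ∨ κ = ν then (P.L : ℤ) else 0) + (((P.L - 1) / 2 : ℕ) : ℤ)) z) :
    blockOf (transl (emb y) z) = y ∨ blockOf (transl (emb y) z) = y.shift μ ∨ blockOf (transl (emb y) z) = y.shift ν ∨
      blockOf (transl (emb y) z) = (y.shift μ).shift ν :=
  blockOf_mem_four_of_near hj y hμν _ z (fun κ => transl_apply _ _ κ) (fun κ => (hz κ).1) (fun κ => (hz κ).2)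

omit [NormOneClass 𝔸] in
/-- The periodic pullback about `emb y` has `‖·‖, ‖·⁻¹‖ ≤ K` on the bonds of the four-block box when `U` does on the bonds with both ends in the four blocks. [folklore] -/
theorem pull_growth_of_fourBlock (hj : j + 1 ≤ P.m + P.K) {U : GaugeField P j 𝔸ˣ} (y : Site P (j + 1)) {μ ν : Fin P.d} (hμν : μ ≠ ν) {K : ℝ}
    (hK : ∀ b : PBond P j, (blockOf b.src = y ∨ blockOf b.src = y.shift μ ∨ blockOf b.src = y.shift ν ∨ blockOf b.src = (y.shift μ).shift ν) →
      (blockOf b.tgt = y ∨ blockOf b.tgt = y.shift μ ∨ blockOf b.tgt = y.shift ν ∨ blockOf b.tgt = (y.shift μ).shift ν) →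
      ‖((U b : 𝔸ˣ) : 𝔸)‖ ≤ K ∧ ‖(((U b)⁻¹ : 𝔸ˣ) : 𝔸)‖ ≤ K)
    (z : LSite P.d) (κ : Fin P.d)
    (hz : InBox (fun _ => -(((P.L - 1) / 2 : ℕ) : ℤ)) (fun κ => (if κ = μ ∨ κ = ν then (P.L : ℤ) else 0) + (((P.L - 1) / 2 : ℕ) : ℤ)) z)
    (hzκ : InBox (fun _ => -(((P.L - 1) / 2 : ℕ) : ℤ)) (fun κ => (if κ = μ ∨ κ = ν then (P.L : ℤ) else 0) + (((P.L - 1) / 2 : ℕ) : ℤ)) (z + e κ)) :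
    ‖((pull U (emb y) z κ : 𝔸ˣ) : 𝔸)‖ ≤ K ∧ ‖(((pull U (emb y) z κ)⁻¹ : 𝔸ˣ) : 𝔸)‖ ≤ K := by
  rw [pull_apply]
  refine hK _ (blockOf_transl_emb_four hj y hμν hz) ?_
  rw [PBond.tgt, ← transl_add_e]
  exact blockOf_transl_emb_four hj y hμν hzκ

omit [NormOneClass 𝔸] in
/-- The plaquette variables of the pullback inside the four-block box, both orientations, are within `K⁴a` of `1` when the plaquettes of `U` with all four corners in the
four blocks are within `a` and the bond variables there have `‖·‖, ‖·⁻¹‖ ≤ K` (`K ≥ 1`). [cite: Balaban1985Averaging, (9) p.19 and (19)-(20) p.21] -/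
theorem norm_hol_pull_plaqWord_sub_one_le_of_fourBlock_growth (hj : j + 1 ≤ P.m + P.K) {U : GaugeField P j 𝔸ˣ} (y : Site P (j + 1)) {μ ν : Fin P.d}
    (hμν : μ ≠ ν) {K a : ℝ} (hK1 : 1 ≤ K) (ha : 0 ≤ a)
    (hK : ∀ b : PBond P j, (blockOf b.src = y ∨ blockOf b.src = y.shift μ ∨ blockOf b.src = y.shift ν ∨ blockOf b.src = (y.shift μ).shift ν) →
      (blockOf b.tgt = y ∨ blockOf b.tgt = y.shift μ ∨ blockOf b.tgt = y.shift ν ∨ blockOf b.tgt = (y.shift μ).shift ν) →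
      ‖((U b : 𝔸ˣ) : 𝔸)‖ ≤ K ∧ ‖(((U b)⁻¹ : 𝔸ˣ) : 𝔸)‖ ≤ K)
    (hplaq : ∀ p : Plaq P j,
      (blockOf p.src = y ∨ blockOf p.src = y.shift μ ∨ blockOf p.src = y.shift ν ∨ blockOf p.src = (y.shift μ).shift ν) →
      (blockOf (p.src.shift p.μ) = y ∨ blockOf (p.src.shift p.μ) = y.shift μ ∨ blockOf (p.src.shift p.μ) = y.shift ν ∨
        blockOf (p.src.shift p.μ) = (y.shift μ).shift ν) →
      (blockOf (p.src.shift p.ν) = y ∨ blockOf (p.src.shift p.ν) = y.shift μ ∨ blockOf (p.src.shift p.ν) = y.shift ν ∨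
        blockOf (p.src.shift p.ν) = (y.shift μ).shift ν) →
      (blockOf ((p.src.shift p.μ).shift p.ν) = y ∨ blockOf ((p.src.shift p.μ).shift p.ν) = y.shift μ ∨ blockOf ((p.src.shift p.μ).shift p.ν) = y.shift ν ∨
        blockOf ((p.src.shift p.μ).shift p.ν) = (y.shift μ).shift ν) →
      ‖((plaq U p : 𝔸ˣ) : 𝔸) - 1‖ ≤ a)
    (z : LSite P.d) (κ κ' : Fin P.d) (hκκ' : κ ≠ κ')
    (hp : PlaqIn (fun _ => -(((P.L - 1) / 2 : ℕ) : ℤ)) (fun κ => (if κ = μ ∨ κ = ν then (P.L : ℤ) else 0) + (((P.L - 1) / 2 : ℕ) : ℤ)) (z, κ, κ')) :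
    ‖((hol (pull U (emb y)) z (plaqWord κ κ') : 𝔸ˣ) : 𝔸) - 1‖ ≤ K ^ 4 * a := by
  have hK0 : 0 ≤ K := zero_le_one.trans hK1
  obtain ⟨hz, hzκμ⟩ := hp
  have hzκ := inBox_add_e_of_inBox_add_add hz hzκμ
  have hzμκ : InBox (fun _ => -(((P.L - 1) / 2 : ℕ) : ℤ)) (fun κ => (if κ = μ ∨ κ = ν then (P.L : ℤ) else 0) + (((P.L - 1) / 2 : ℕ) : ℤ)) (z + e κ' + e κ) := by
    rwa [add_right_comm]
  have hzμ := inBox_add_e_of_inBox_add_add hz hzμκ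
  have c1 := blockOf_transl_emb_four hj y hμν hz
  have c2 := blockOf_transl_emb_four hj y hμν hzκ
  have c3 := blockOf_transl_emb_four hj y hμν hzμ
  have c4 := blockOf_transl_emb_four hj y hμν hzκμ
  have c4' := blockOf_transl_emb_four hj y hμν hzμκ
  rw [transl_add_e] at c2 c3
  rw [transl_add_e, transl_add_e] at c4 c4'
  rw [hol_pull]
  have h4 : a ≤ K ^ 4 * a := by have : (1 : ℝ) ≤ K ^ 4 := one_le_pow₀ hK1; nlinarith
  rcases lt_or_gt_of_ne hκκ' with hlt | hgt
  · have h := hplaq ⟨transl (emb y) z, κ, κ', hlt⟩ c1 c2 c3 c4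
    rw [plaq_eq, ← holT_plaqWord] at h
    exact h.trans h4
  · have h := hplaq ⟨transl (emb y) z, κ', κ, hgt⟩ c1 c3 c2 c4'
    rw [plaq_eq, ← holT_plaqWord] at h
    set Q := holT U (transl (emb y) z) (plaqWord κ' κ) with hQ
    have hQ4 : ‖((Q⁻¹ : 𝔸ˣ) : 𝔸)‖ ≤ K ^ 4 := by
      rw [hQ, holT_plaqWord]
      exact norm_plaq_inv_le_growth hK0 (hK ⟨transl (emb y) z, κ'⟩ c1 c3).2 (hK ⟨(transl (emb y) z).shift κ', κ⟩ c3 c4').2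
        (hK ⟨(transl (emb y) z).shift κ, κ'⟩ c2 c4).1 (hK ⟨transl (emb y) z, κ⟩ c1 c2).1
    rw [holT_plaqWord_swap, ← hQ]
    have h1 : ‖((Q⁻¹ : 𝔸ˣ) : 𝔸) - 1‖ ≤ ‖((Q⁻¹ : 𝔸ˣ) : 𝔸)‖ * ‖(Q : 𝔸) - 1‖ := by
      rw [show ((Q⁻¹ : 𝔸ˣ) : 𝔸) - 1 = ((Q⁻¹ : 𝔸ˣ) : 𝔸) * (1 - (Q : 𝔸)) by rw [mul_sub, mul_one, Units.inv_mul], ← norm_sub_rev (1 : 𝔸) (Q : 𝔸)]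
      exact norm_mul_le _ _
    exact h1.trans (mul_le_mul hQ4 h (norm_nonneg _) (pow_nonneg hK0 4))

/-- ★ **THE SIDE-`L` SQUARE OF A NORM-BOUNDED CONFIGURATION FROM THE PLAQUETTES OF THE FOUR-BLOCK BOX**: if `‖U(b)‖, ‖U(b)⁻¹‖ ≤ K` (`K ≥ 1`) on the bonds with both
ends in `B(y) ∪ B(y+e_μ) ∪ B(y+e_ν) ∪ B(y+e_μ+e_ν)` (`μ ≠ ν`) and `‖∂U(p) − 1‖ ≤ a` on the plaquettes with all four corners there, then the square
`𝐔(∂□) = 𝐔_{emb y}((+e_μ)^L (+e_ν)^L (−e_μ)^L (−e_ν)^L)` satisfies `‖𝐔(∂□) − 1‖ ≤ (1 + γ₄)^{4L} − 1`, `γ₄ = K^{2R+1}·(K^{4R}·(R·K⁶(K⁴a)·(K²(1+K⁶(K⁴a)))^R))`,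
`R = ⌊(d+4)L∕2⌋` ((7a) ★★★ on the periodic pullback about `emb y`). [cite: Balaban1985Averaging, (19)-(20) p.21, pp.24-25 and Prop. 1 p.26] -/
theorem norm_holT_rectWord_sub_one_le_of_plaq_fourBlock_growth (hj : j + 1 ≤ P.m + P.K) {U : GaugeField P j 𝔸ˣ} (y : Site P (j + 1)) {μ ν : Fin P.d}
    (hμν : μ ≠ ν) {K a : ℝ} (hK1 : 1 ≤ K) (ha : 0 ≤ a)
    (hK : ∀ b : PBond P j, (blockOf b.src = y ∨ blockOf b.src = y.shift μ ∨ blockOf b.src = y.shift ν ∨ blockOf b.src = (y.shift μ).shift ν) →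
      (blockOf b.tgt = y ∨ blockOf b.tgt = y.shift μ ∨ blockOf b.tgt = y.shift ν ∨ blockOf b.tgt = (y.shift μ).shift ν) →
      ‖((U b : 𝔸ˣ) : 𝔸)‖ ≤ K ∧ ‖(((U b)⁻¹ : 𝔸ˣ) : 𝔸)‖ ≤ K)
    (hplaq : ∀ p : Plaq P j,
      (blockOf p.src = y ∨ blockOf p.src = y.shift μ ∨ blockOf p.src = y.shift ν ∨ blockOf p.src = (y.shift μ).shift ν) →
      (blockOf (p.src.shift p.μ) = y ∨ blockOf (p.src.shift p.μ) = y.shift μ ∨ blockOf (p.src.shift p.μ) = y.shift ν ∨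
        blockOf (p.src.shift p.μ) = (y.shift μ).shift ν) →
      (blockOf (p.src.shift p.ν) = y ∨ blockOf (p.src.shift p.ν) = y.shift μ ∨ blockOf (p.src.shift p.ν) = y.shift ν ∨
        blockOf (p.src.shift p.ν) = (y.shift μ).shift ν) →
      (blockOf ((p.src.shift p.μ).shift p.ν) = y ∨ blockOf ((p.src.shift p.μ).shift p.ν) = y.shift μ ∨ blockOf ((p.src.shift p.μ).shift p.ν) = y.shift ν ∨
        blockOf ((p.src.shift p.μ).shift p.ν) = (y.shift μ).shift ν) →
      ‖((plaq U p : 𝔸ˣ) : 𝔸) - 1‖ ≤ a) :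
    ‖((holT U (emb y) (rectWord μ ν P.L P.L) : 𝔸ˣ) : 𝔸) - 1‖ ≤
      (1 + K ^ (2 * ((P.d + 4) * P.L / 2) + 1) * (K ^ (4 * ((P.d + 4) * P.L / 2)) * (((P.d + 4) * P.L / 2 : ℕ) * (K ^ 6 * (K ^ 4 * a)) *
        (K ^ 2 * (1 + K ^ 6 * (K ^ 4 * a))) ^ ((P.d + 4) * P.L / 2)))) ^ (4 * P.L) - 1 := by
  have hK0 : 0 ≤ K := zero_le_one.trans hK1
  have hw0 : disp (rectWord μ ν P.L P.L) = 0 := funext fun κ => by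
    rw [disp_apply_eq_netDisp]; exact netDisp_rectWord μ ν P.L P.L κ
  have hmain := norm_hol_closed_sub_one_le_inBox_growth (fourBlockBox_lo_le_hi μ ν) hK1 (pull_growth_of_fourBlock hj y hμν hK)
    (mul_nonneg (pow_nonneg hK0 4) ha) (norm_hol_pull_plaqWord_sub_one_le_of_fourBlock_growth hj y hμν hK1 ha hK hplaq) 0
    (l1_le_half_of_inBox_fourBlock μ ν) _ hw0 (inBox_disp_take_rectWord hμν)
  rw [hol_pull_zero] at hmain
  have hlen : (rectWord μ ν P.L P.L).length = 4 * P.L := by simp only [rectWord, List.length_append, List.length_replicate]; ring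
  rwa [hlen] at hmain

end FourBlock

end YMDAG.N18.BoxStokes

end
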